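import Summits.SmoothPoincare4.SmoothPoincare4.Theorems.CylinderEntropyCylinderRungTwoFluxIdentityCharts
import Summits.SmoothPoincare4.SmoothPoincare4.Theorems.CylinderEntropyCylinderRungTwoTiltExcess
import Literature.Geometry.Riemannian.SphericalCylinderEntropy
import HarnessLib

/-!
# Route `CylinderEntropy`, crux `CylinderRungTwo` (stmt-SmoothPoincare4-7631), line `killing-flux`:
# CAUCHY–SCHWARZ FOR THE TOTAL MEAN CURVATURE in `ℝ≥0∞`
# (registered helper `helper_firstVariationBound`, step S0 of the area-quantization plan)

For a closed embedded cross-section `ι : M⁴ → ℝ⁶` (immersion data `himm`, smooth normal field `ν`)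
with mean curvature `H` (tree `meanCurvature` of `(ι, ν)` in `ℝ⁶`) and induced area measure
`m = ι^* μH⁴ = Measure.comap ι μH[4]`, the total mean curvature is controlled by the area and the
Willmore-type energy:

  `∫⁻ |H| dm ≤ (μH⁴(ι(M)))^{1/2} · (∫⁻ H² dm)^{1/2}`.

This is Hölder's inequality for lower Lebesgue integrals with exponents `p = q = 2`
(`ENNReal.lintegral_mul_le_Lp_mul_Lq`) applied to the pair `(1, ofReal |H|)`, together with
`m(M) = μH⁴(ι(M))` (a smooth embedding of a compact manifold is a measurable embedding,
`measurableEmbedding_of_emb`, so `MeasurableEmbedding.comap_apply` applies) and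
`(ofReal |H|)² = ofReal (H²)`. Measurability of `H` comes from its continuity
(`continuous_meanCurvature_euclidean`).

* `lintegral_ofReal_abs_le_rpow_mul_rpow` — the abstract Cauchy–Schwarz bound
  `∫⁻ |h| dμ ≤ μ(univ)^{1/2} (∫⁻ h² dμ)^{1/2}` for an a.e.-measurable real function `h`;
* `lintegral_abs_meanCurvature_comap_le` — the bound for `m = ι^* μH⁴`, implicit binders;
* `helper_firstVariationBound` — the registered helper, verbatim.

No case distinction on `M = ∅` or `m = 0` is needed (both sides vanish). Everything here is PROVED
(no `sorry`, no new definitions, no named facts).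

References: L. Simon, *Lectures on Geometric Measure Theory* (1983), §16–§17 (first variation and the
role of `‖H‖_{L¹} ≤ area^{1/2} ‖H‖_{L²}` in the monotonicity formula).
-/

-- the prescribed namespace `Summit.SmoothPoincare4.SmoothPoincare4.…` repeats `SmoothPoincare4`
set_option linter.dupNamespace false

noncomputable section

open Set Function Filter MeasureTheory
open scoped Manifold ContDiff ENNReal NNReal Topology BigOperators

namespace Summit.SmoothPoincare4.SmoothPoincare4.Cruxes.CylinderRungTwo.KillingFlux

open Literature.Geometry.Riemannian Literature.Geometry.Lorentzian
  Literature.Geometry.Lorentzian.PseudoRiemannianMetric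
open Summit.SmoothPoincare4.SmoothPoincare4.Theorems.CylinderRungTwo.KillingFlux
  (measurableEmbedding_of_emb)

/-! ## Abstract Cauchy–Schwarz in `ℝ≥0∞` -/

section Abstract

variable {X : Type*} [MeasurableSpace X]

/-- **Cauchy–Schwarz for the lower Lebesgue integral of `|h|`.** For an a.e.-measurable real
function `h` on a measure space `(X, μ)`,
`∫⁻ ofReal |h| dμ ≤ μ(univ)^{1/2} · (∫⁻ ofReal (h²) dμ)^{1/2}`: Hölder with `p = q = 2`
(`ENNReal.lintegral_mul_le_Lp_mul_Lq`) for the pair `(1, ofReal |h|)`, `∫⁻ 1 dμ = μ(univ)` and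
`(ofReal |h|)² = ofReal (h²)`. [folklore] -/
theorem lintegral_ofReal_abs_le_rpow_mul_rpow (μ : Measure X) {h : X → ℝ}
    (hh : AEMeasurable h μ) :
    ∫⁻ x, ENNReal.ofReal |h x| ∂μ ≤
      (μ univ) ^ (1 / 2 : ℝ) * (∫⁻ x, ENNReal.ofReal (h x ^ 2) ∂μ) ^ (1 / 2 : ℝ) := by
  have hf : AEMeasurable (fun x => ENNReal.ofReal |h x|) μ := hh.abs.ennreal_ofReal
  have H := ENNReal.lintegral_mul_le_Lp_mul_Lq μ Real.HolderConjugate.two_two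
    (f := fun _ => (1 : ℝ≥0∞)) aemeasurable_const hf
  have hsq : ∀ x, ENNReal.ofReal |h x| ^ (2 : ℝ) = ENNReal.ofReal (h x ^ 2) := fun x => by
    rw [ENNReal.rpow_two, ← ENNReal.ofReal_pow (abs_nonneg _), sq_abs]
  simp only [Pi.mul_apply, one_mul, ENNReal.one_rpow, lintegral_const, hsq] at H
  exact H

end Abstract

/-! ## The bound for the induced area measure `ι^* μH⁴` -/

section Slice

variable {M : Type} [TopologicalSpace M] [ChartedSpace (EuclideanSpace ℝ (Fin 4)) M]
  [IsManifold (𝓡 4) ∞ M] [CompactSpace M] [MeasurableSpace M] [BorelSpace M]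

/-- **Cauchy–Schwarz for the total mean curvature of a closed embedded cross-section**
`ι : M⁴ → ℝ⁶` with smooth normal field `ν`, mean curvature `H` of `(ι, ν)` and induced area
measure `m = ι^* μH⁴`: `∫⁻ |H| dm ≤ (μH⁴(ι(M)))^{1/2} (∫⁻ H² dm)^{1/2}`. The abstract bound
`lintegral_ofReal_abs_le_rpow_mul_rpow` (with `H` measurable, being continuous) and
`m(M) = μH⁴(ι '' M) = μH⁴(range ι)` (`ι` is a measurable embedding). [folklore] -/
theorem lintegral_abs_meanCurvature_comap_le {ι ν : M → EuclideanSpace ℝ (Fin 6)}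
    (hι : Manifold.IsSmoothEmbedding (𝓡 4) (𝓡 6) ∞ ι)
    (himm : (euclideanMetric (EuclideanSpace ℝ (Fin 6))).IsSpacelikeImmersion (𝓡 4) ι)
    (hν : ContMDiff (𝓡 4) (𝓡 6) ∞ ν) :
    ∫⁻ x, ENNReal.ofReal
        |(euclideanMetric (EuclideanSpace ℝ (Fin 6))).meanCurvature ι contMDiff_pullbackBilin_holds
          himm ν x| ∂(Measure.comap ι (μH[4] : Measure (EuclideanSpace ℝ (Fin 6)))) ≤
      (μH[4] (Set.range ι)) ^ (1 / 2 : ℝ) *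
        (∫⁻ x, ENNReal.ofReal
          ((euclideanMetric (EuclideanSpace ℝ (Fin 6))).meanCurvature ι contMDiff_pullbackBilin_holds
            himm ν x ^ 2) ∂(Measure.comap ι (μH[4] : Measure (EuclideanSpace ℝ (Fin 6))))) ^
          (1 / 2 : ℝ) := by
  have hme : MeasurableEmbedding ι := measurableEmbedding_of_emb hι
  have hH : AEMeasurable (fun x => (euclideanMetric (EuclideanSpace ℝ (Fin 6))).meanCurvature ι
      contMDiff_pullbackBilin_holds himm ν x)
      (Measure.comap ι (μH[4] : Measure (EuclideanSpace ℝ (Fin 6)))) :=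
    (continuous_meanCurvature_euclidean himm hν).measurable.aemeasurable
  have h := lintegral_ofReal_abs_le_rpow_mul_rpow
    (Measure.comap ι (μH[4] : Measure (EuclideanSpace ℝ (Fin 6)))) hH
  rwa [hme.comap_apply, image_univ] at h

end Slice

/-! ## The registered helper -/

/-- **Registered helper `helper_firstVariationBound`** (step S0 of the area-quantization plan of
`stub_areaQuantization`, line `killing-flux`): for a closed embedded cross-section `ι : M⁴ → ℝ⁶`
with immersion data `himm`, smooth normal field `ν`, mean curvature `H` and induced area measure
`m = ι^* μH⁴`, the Cauchy–Schwarz bound `∫⁻ |H| dm ≤ (μH⁴(range ι))^{1/2} (∫⁻ H² dm)^{1/2}`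
(`lintegral_abs_meanCurvature_comap_le`, verbatim registered signature). [folklore] -/
theorem helper_firstVariationBound : ∀ (M : Type) [TopologicalSpace M] [T2Space M] [SecondCountableTopology M] [ChartedSpace (EuclideanSpace ℝ (Fin 4)) M] [IsManifold (𝓡 4) ∞ M] [CompactSpace M] [MeasurableSpace M] [BorelSpace M] (ι ν : M → EuclideanSpace ℝ (Fin 6)), Manifold.IsSmoothEmbedding (𝓡 4) (𝓡 6) ∞ ι → ∀ himm : (euclideanMetric (EuclideanSpace ℝ (Fin 6))).IsSpacelikeImmersion (𝓡 4) ι, ContMDiff (𝓡 4) (𝓡 6) ∞ ν → ∫⁻ x, ENNReal.ofReal |(euclideanMetric (EuclideanSpace ℝ (Fin 6))).meanCurvature ι contMDiff_pullbackBilin_holds himm ν x| ∂(Measure.comap ι (μH[4] : Measure (EuclideanSpace ℝ (Fin 6)))) ≤ (μH[4] (Set.range ι)) ^ (1 / 2 : ℝ) * (∫⁻ x, ENNReal.ofReal ((euclideanMetric (EuclideanSpace ℝ (Fin 6))).meanCurvature ι contMDiff_pullbackBilin_holds himm ν x ^ 2) ∂(Measure.comap ι (μH[4] : Measure (EuclideanSpace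 ℝ (Fin 6))))) ^ (1 / 2 : ℝ) :=
  fun _ _ _ _ _ _ _ _ _ _ _ hι himm hν => lintegral_abs_meanCurvature_comap_le hι himm hν

end Summit.SmoothPoincare4.SmoothPoincare4.Cruxes.CylinderRungTwo.KillingFlux
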